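import Summits.Ventures.CertifiedManyBodySolver.Rows.HubbardChainMPSNodesSrot
import Summits.Ventures.CertifiedManyBodySolver.Transport.MPSPrimalSrotTrace

/-!
# Row predicate for the `ksdn-inst/1` / `ksdn-cert/1` rows of the Hubbard chain (`jw-srot` form, `t = 1`): the `mps(N, D, A)` node
# WITH TRACE BOUNDS `MPSChainKSDNTrNodeSrot`, and its solver-free EDGES to `LTIChainKSDNNodeSrot` / `LTIChainKSDNNode` and the M1 cells

HONEST FRAMING: first certified bounds; not a superconductivity verdict; every number certified or labelled float.

WHAT THIS FILE IS (programme hubbard-alg, LIT team lit-1 gen-15; '→ lit-1' ask of lit-4 g11, HOME/INBOX l.7462, for the FIRST KSDN/LTI-format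
row of the programme = CERTIFIED #348, L3 eng-3 instance `ksdn-inst/1` + L4 certificate `ksdn-cert/1`, ref-1 R1.84). FORMAT-ksdn
(`hubbard-alg/L3-hybrid/eng-3/FORMAT-ksdn.md` §1 `bounds` + §3 verdict) certifies `E ≥ E_cert = β − Σ_m r_m · max_tag δ_(m,tag)` with
"B_m = r_m bounds **Tr ω_m** of the physical feasible point": a lower bound over {FORMAT-ltisdp §4.7 rows VERBATIM (trace, LTI3, density,
E4L/E4R, E_mL/E_mR; `drop_dependent` ⊂), blocks PSD, `Tr ω_m ≤ r_m` (`4 ≤ m ≤ N`), `Tr ρ₃ = 1`}. The sibling node `MPSChainKSDNNodeSrot`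
(`Rows/HubbardChainMPSNodesSrot.lean`, lit-1 gen-13) quantifies over FORMAT-ltisdp §4.7's ENTRY-bounded set `|ω_m[i,j]| ≤ B_m` (lane-B
`cert0` semantics) and is therefore NOT instantiated by a ksdn certificate (under entry bounds `Tr ω_m` may reach `Σ_tags n_tag · B_m`).

`MPSChainKSDNTrNodeSrot U n D A qb cb ca B ν lo` := the 15 binders of `MPSChainKSDNNodeSrot U n D A qb cb ca B ν lo` VERBATIM plus ONE binder
per level, `Re tr ω_{k+4} ≤ B (k+4)` (`k + 4 ≤ n + 3`), then the same conclusion `lo ≤ Re tr(h_srot ρ₃)`. Hence: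
* `MPSChainKSDNNodeSrot.trNode` — the entry-bounded node implies the trace-bounded node (more hypotheses, same conclusion), so lane-B
  `jw-srot` rows land here too;
* `MPSChainKSDNTrNodeSrot.ltiChainKSDNNodeSrot` / `.ltiChainKSDNNode` — solver-free EDGES under the same two RATIONAL side conditions as the
  sibling (charge covariance of `A` for `hubbardSrotQeff cb ca`; `frobSqQ (transferOpQ A ^ (m−2)) ≤ (B m)²`, `0 ≤ B m` — the latter makes BOTH
  the entry bounds and the trace bounds a-priori valid: `Transport.exists_mpsRowsTr_of_window`, `Transport.ksdnSrotClaim_of_mpsSrotTrClaim`);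
* the M1 cells BY NAME `….m1EnergyLowerRow` (`ν = 1`), `….m1DopedEnergyLowerRow` (`ν = p/q`); `….mono`.
By-name audit token of an instance: predicate NAME `MPSChainKSDNTrNodeSrot` + `(U, n + 3 = relax.n, D = bond_dims[0], ν = filling, lo =
claimed.lower_bound)` + tables `A = tensor.A_num / 2^exponent_b` (exactly), `qb = tensor.bond_charges[0]`, `(cb, ca)` from `model.q_eff =
cb·n_tot − ca`, `B m = bounds.levels[m].r` (`bounds.B3 = 1` is the trace row of `ρ₃`).

NOTHING IS ASSERTED HERE: the node is a `def … : Prop` taken as a hypothesis; nodes are instantiated only under `Certificates/` from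
certificate files. No `sorry`, no new axiom, no named fact. [cite: KullEtAl2024, §2.3–2.5, §4.2, §6.2] [cite: ArakiMoriya2003, §4.1]
[cite: EsslerEtAl2005, §12.3.4 eqs. (12.196)–(12.201)]
-/

noncomputable section

open Matrix Complex Filter Topology
open scoped ComplexOrder Kronecker BigOperators
open Literature.Probability.LatticeModels
open Literature.MathematicalPhysics.QuantumLattice
open Literature.MathematicalPhysics.QuantumLattice.HubbardWave0
open Literature.MathematicalPhysics.QuantumLattice.ThermodynamicLimit
open Literature.MathematicalPhysics.QuantumLattice.JordanWigner
open Literature.MathematicalPhysics.QuantumManyBody.StateRelaxation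
open Literature.MathematicalPhysics.QuantumLattice.MPSCoarseGraining
open Literature.Computability.QuantumComplexity (traceLeft traceRight)
open Summit.Ventures.CertifiedManyBodySolver.Transport

namespace Summit.Ventures.CertifiedManyBodySolver

/-! ## §A  The node predicate (window `{-1, …, n+1}` of `N = n + 3` sites, model `hubbard_jwsrot(U)`, `t = 1`, TRACE-bounded levels) -/

section Nodes

/-- **`jw-srot` `relax = mps(N, D, A)` node WITH TRACE BOUNDS, `ksdn-inst/1` form** (the `hclaim` of
`Transport.ksdnSrotClaim_of_mpsSrotTrClaim` at `t = 1` with rational data; model `hubbard_jwsrot(U)`, FORMAT-ltisdp §4.7/§4.11 rows,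
FORMAT-ksdn §1 bounds): for all variables `ρ₃ : Op (PolySite {-1,0,1}) 4` and `ω m` (`4 ≤ m ≤ n + 3`, indexed `(s_L, (a,b), s_R)`), IF
`ρ₃ ⪰ 0`, `tr ρ₃ = 1`, the LTI row `tr_{-1} ρ₃ = tr_{1} ρ₃`, the TOTAL-OCCUPATION sector zeros, the total density of site `-1` equal to `ν`,
real entries, `|ρ₃| ≤ 1`; rows E4L / E4R (through `chainWindowThreeEquiv`, `W₂ = cgMap (castTensor A) 2`), E_mL / E_mR for `5 ≤ m ≤ n+3`
(`L = leftMap`, `R = rightMap` of `castTensor A`); `ω_m ⪰ 0`, sector zeros for `cgTag (hubbardSrotQeff cb ca) qb`, real entries,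
`|ω_m| ≤ B m` AND `Re tr ω_m ≤ B m` (`4 ≤ m ≤ n+3`) — THEN `lo ≤ Re tr(toSpin(U n_{-1↑}n_{-1↓} − Σ_σ (c†_{-1σ} c_{0σ̄} + c†_{0σ̄} c_{-1σ})) ρ₃)`
(`jw-srot` bond, `U` on the LEFT site, `t = 1`). VERBATIM `MPSChainKSDNNodeSrot U n D A qb cb ca B ν lo` with the one extra binder
`∀ k, k + 4 ≤ n + 3 → Re tr (ω (k+4)) ≤ B (k+4)`. By-name audit token: predicate NAME + `(U, n + 3 = the file's n, D, ν, lo)` + the tables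
`A`, `qb`, `(cb, ca)`, `B m` (= `bounds.levels[m].r`). [cite: KullEtAl2024, §2.5 eq. (TNfullRelax5), §4.2 eq. (relaxLocTIn), §6.2] -/
def MPSChainKSDNTrNodeSrot (U : ℝ) (n D : ℕ) (A : Fin 4 → Matrix (Fin D) (Fin D) ℚ) (qb : Fin D → ℤ) (cb ca : ℤ) (B : ℕ → ℚ)
    (ν lo : ℚ) : Prop :=
  ∀ (ρ₃ : Op (PolySite (chainWindow (-1) 1)) 4)
    (ω : ℕ → Matrix (Fin 4 × ((Fin D × Fin D) × Fin 4)) (Fin 4 × ((Fin D × Fin D) × Fin 4)) ℂ),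
    ρ₃.PosSemidef → ρ₃.trace = 1 →
    spinPartialTrace ((PolySite.affEmb 1 (unitVec 0) (chainWindow (-1) 0)).trans
        (PolySite.incl affShiftSet_chainWindow_zero_subset_one)) ρ₃ =
      spinPartialTrace (PolySite.incl chainWindow_zero_subset_one) ρ₃ →
    (∀ k k' : TensorIndex (PolySite (chainWindow (-1) 1)) 4,
      (∑ x, (siteOcc (k x)).card) ≠ (∑ x, (siteOcc (k' x)).card) → ρ₃ k k' = 0) →
    ((toSpin (nAt (-unitVec 0) neg_unitVec_mem_chainWindow_one 0 + nAt (-unitVec 0) neg_unitVec_mem_chainWindow_one 1) *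
        ρ₃).trace).re = ((ν : ℚ) : ℝ) →
    (∀ k k' : TensorIndex (PolySite (chainWindow (-1) 1)) 4, starRingEnd ℂ (ρ₃ k k') = ρ₃ k k') →
    (∀ k k' : TensorIndex (PolySite (chainWindow (-1) 1)) 4, ‖ρ₃ k k'‖ ≤ 1) →
    traceLeft (ω 4) = (cgMap (castTensor A) 2 ⊗ₖ (1 : Matrix (Fin 4) (Fin 4) ℂ)) *
        (ρ₃.submatrix (Equiv.arrowCongr chainWindowThreeEquiv (Equiv.refl (Fin 4)))
            (Equiv.arrowCongr chainWindowThreeEquiv (Equiv.refl (Fin 4)))).submatrix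
          ((Equiv.prodComm _ _).trans (Fin.snocEquiv fun _ => Fin 4))
          ((Equiv.prodComm _ _).trans (Fin.snocEquiv fun _ => Fin 4)) *
      (cgMap (castTensor A) 2 ⊗ₖ (1 : Matrix (Fin 4) (Fin 4) ℂ))ᴴ →
    traceRight ((ω 4).submatrix (Equiv.prodAssoc _ _ _) (Equiv.prodAssoc _ _ _)) =
      ((1 : Matrix (Fin 4) (Fin 4) ℂ) ⊗ₖ cgMap (castTensor A) 2) *
        (ρ₃.submatrix (Equiv.arrowCongr chainWindowThreeEquiv (Equiv.refl (Fin 4)))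
            (Equiv.arrowCongr chainWindowThreeEquiv (Equiv.refl (Fin 4)))).submatrix
          (Fin.consEquiv fun _ => Fin 4) (Fin.consEquiv fun _ => Fin 4) *
      ((1 : Matrix (Fin 4) (Fin 4) ℂ) ⊗ₖ cgMap (castTensor A) 2)ᴴ →
    (∀ k, k + 5 ≤ n + 3 → traceLeft (ω (k + 5)) =
      (leftMap (castTensor A) ⊗ₖ (1 : Matrix (Fin 4) (Fin 4) ℂ)) *
        (ω (k + 4)).submatrix (Equiv.prodAssoc _ _ _) (Equiv.prodAssoc _ _ _) *
      (leftMap (castTensor A) ⊗ₖ (1 : Matrix (Fin 4) (Fin 4) ℂ))ᴴ) →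
    (∀ k, k + 5 ≤ n + 3 → traceRight ((ω (k + 5)).submatrix (Equiv.prodAssoc _ _ _) (Equiv.prodAssoc _ _ _)) =
      ((1 : Matrix (Fin 4) (Fin 4) ℂ) ⊗ₖ rightMap (castTensor A)) * ω (k + 4) *
      ((1 : Matrix (Fin 4) (Fin 4) ℂ) ⊗ₖ rightMap (castTensor A))ᴴ) →
    (∀ k, k + 4 ≤ n + 3 → (ω (k + 4)).PosSemidef) →
    (∀ k, k + 4 ≤ n + 3 → ∀ i j, cgTag (hubbardSrotQeff cb ca) qb i ≠ cgTag (hubbardSrotQeff cb ca) qb j → ω (k + 4) i j = 0) →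
    (∀ k, k + 4 ≤ n + 3 → ∀ i j, starRingEnd ℂ (ω (k + 4) i j) = ω (k + 4) i j) →
    (∀ k, k + 4 ≤ n + 3 → ∀ i j, ‖ω (k + 4) i j‖ ≤ ((B (k + 4) : ℚ) : ℝ)) →
    (∀ k, k + 4 ≤ n + 3 → ((ω (k + 4)).trace).re ≤ ((B (k + 4) : ℚ) : ℝ)) →
    ((lo : ℚ) : ℝ) ≤ ((toSpin ((U : ℂ) • (nAt (-unitVec 0) neg_unitVec_mem_chainWindow_one 0 *
          nAt (-unitVec 0) neg_unitVec_mem_chainWindow_one 1) +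
        (-((1 : ℝ) : ℂ)) • ∑ σ : Fin 2,
          ((cAt (-unitVec 0) neg_unitVec_mem_chainWindow_one σ)ᴴ * cAt 0 zero_mem_chainWindow_one σ.rev +
            (cAt 0 zero_mem_chainWindow_one σ.rev)ᴴ * cAt (-unitVec 0) neg_unitVec_mem_chainWindow_one σ)) * ρ₃).trace).re

end Nodes

/-! ## §B  Solver-free edges: monotonicity, entry node ⇒ trace node, `mps`-with-trace-bounds ⇒ window -/

section Edges

variable {U : ℝ} {n D : ℕ} {A : Fin 4 → Matrix (Fin D) (Fin D) ℚ} {qb : Fin D → ℤ} {cb ca : ℤ} {B : ℕ → ℚ} {ν lo lo' : ℚ}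

/-- A node survives a SMALLER slot `lo' ≤ lo`. -/
theorem MPSChainKSDNTrNodeSrot.mono (h : MPSChainKSDNTrNodeSrot U n D A qb cb ca B ν lo) (hlo : lo' ≤ lo) :
    MPSChainKSDNTrNodeSrot U n D A qb cb ca B ν lo' :=
  fun ρ₃ ω h1 h2 h3 h4 h5 h6 h7 h8 h9 h10 h11 h12 h13 h14 h15 h16 =>
    le_trans (by exact_mod_cast hlo) (h ρ₃ ω h1 h2 h3 h4 h5 h6 h7 h8 h9 h10 h11 h12 h13 h14 h15 h16)

/-- **Entry-bounded node ⇒ trace-bounded node** (same data, same slot): `MPSChainKSDNNodeSrot … → MPSChainKSDNTrNodeSrot …` — the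
trace-bounded node has MORE hypotheses and the same conclusion. So a lane-B `jw-srot` `cert0` row also instantiates the trace node. -/
theorem MPSChainKSDNNodeSrot.trNode (h : MPSChainKSDNNodeSrot U n D A qb cb ca B ν lo) :
    MPSChainKSDNTrNodeSrot U n D A qb cb ca B ν lo :=
  fun ρ₃ ω h1 h2 h3 h4 h5 h6 h7 h8 h9 h10 h11 h12 h13 h14 h15 _ =>
    h ρ₃ ω h1 h2 h3 h4 h5 h6 h7 h8 h9 h10 h11 h12 h13 h14 h15

/-- **THE `mps`-WITH-TRACE-BOUNDS EDGE BY NAME: a `jw-srot` `ksdn` certificate is a `jw-srot` `lti(N)` certificate** (`N = n + 3 ≥ 4`):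
under the rational side conditions (charge covariance of `A` for `hubbardSrotQeff cb ca`; `frobSqQ (transferOpQ A ^ (m−2)) ≤ (B m)²`,
`0 ≤ B m`), `MPSChainKSDNTrNodeSrot U n D A qb cb ca B ν lo → LTIChainKSDNNodeSrot U n ν lo`. Solver-free: KSDN's feasible point with its
trace bounds (`Transport.ksdnSrotClaim_of_mpsSrotTrClaim`). [cite: KullEtAl2024, §4.2] -/
theorem MPSChainKSDNTrNodeSrot.ltiChainKSDNNodeSrot (h : MPSChainKSDNTrNodeSrot U n D A qb cb ca B ν lo) (hn : 1 ≤ n)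
    (hAcov : ∀ s a b, A s a b ≠ 0 → qb b = qb a + hubbardSrotQeff cb ca s)
    (hB : ∀ k, k + 4 ≤ n + 3 → 0 ≤ B (k + 4) ∧ frobSqQ (transferOpQ A ^ (k + 2)) ≤ B (k + 4) ^ 2) :
    LTIChainKSDNNodeSrot U n ν lo :=
  ksdnSrotClaim_of_mpsSrotTrClaim 1 U n hn (castTensor A) (star_castTensor_apply A) qb cb ca (mpsCovSrot_of_rat hAcov)
    (fun m => ((B m : ℚ) : ℝ)) (mpsBounds_of_rat hB) chainWindowThreeEquiv chainWindowThreeEquiv_coord h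

/-- **`jw-srot` `ksdn` certificate ⇒ standard `lti(N)` certificate** (the composite edge
`MPSChainKSDNTrNodeSrot → LTIChainKSDNNodeSrot → LTIChainKSDNNode`). [cite: KullEtAl2024, §4.2, §VI.B] -/
theorem MPSChainKSDNTrNodeSrot.ltiChainKSDNNode (h : MPSChainKSDNTrNodeSrot U n D A qb cb ca B ν lo) (hn : 1 ≤ n)
    (hAcov : ∀ s a b, A s a b ≠ 0 → qb b = qb a + hubbardSrotQeff cb ca s)
    (hB : ∀ k, k + 4 ≤ n + 3 → 0 ≤ B (k + 4) ∧ frobSqQ (transferOpQ A ^ (k + 2)) ≤ B (k + 4) ^ 2) :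
    LTIChainKSDNNode U n ν lo :=
  (h.ltiChainKSDNNodeSrot hn hAcov hB).ltiChainKSDNNode

end Edges

/-! ## §C  The M1 cells BY NAME (through `LTIChainKSDNNodeSrot`'s cells) -/

section Cells

variable {U : ℝ} {n D : ℕ} {A : Fin 4 → Matrix (Fin D) (Fin D) ℚ} {qb : Fin D → ℤ} {cb ca : ℤ} {B : ℕ → ℚ} {ν lo : ℚ} {p q : ℕ}

/-- **M1 cell BY NAME** (`ν = 1`, `U ≥ 0`): a `jw-srot` `ksdn` node at half filling ⇒ `lo ≤ e₀(U)` (`M1EnergyLowerRow U lo`). -/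
theorem MPSChainKSDNTrNodeSrot.m1EnergyLowerRow (h : MPSChainKSDNTrNodeSrot U n D A qb cb ca B 1 lo) (hn : 1 ≤ n) (hU : 0 ≤ U)
    (hAcov : ∀ s a b, A s a b ≠ 0 → qb b = qb a + hubbardSrotQeff cb ca s)
    (hB : ∀ k, k + 4 ≤ n + 3 → 0 ≤ B (k + 4) ∧ frobSqQ (transferOpQ A ^ (k + 2)) ≤ B (k + 4) ^ 2) :
    M1EnergyLowerRow U lo :=
  (h.ltiChainKSDNNodeSrot hn hAcov hB).m1EnergyLowerRow hU

/-- **M1 doped cell BY NAME** (total density of the first site `ν = p/q`, `1 ≤ q`, `p ≤ 2q`, `U ≥ 0`): `lo ≤ e₀(U, n = p/q)`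
(`M1DopedEnergyLowerRow U p q lo`). -/
theorem MPSChainKSDNTrNodeSrot.m1DopedEnergyLowerRow (h : MPSChainKSDNTrNodeSrot U n D A qb cb ca B ν lo) (hn : 1 ≤ n)
    (hU : 0 ≤ U) (hq : 1 ≤ q) (hp : p ≤ 2 * q) (hν : ((ν : ℚ) : ℝ) = (p : ℝ) / (q : ℝ))
    (hAcov : ∀ s a b, A s a b ≠ 0 → qb b = qb a + hubbardSrotQeff cb ca s)
    (hB : ∀ k, k + 4 ≤ n + 3 → 0 ≤ B (k + 4) ∧ frobSqQ (transferOpQ A ^ (k + 2)) ≤ B (k + 4) ^ 2) :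
    M1DopedEnergyLowerRow U p q lo :=
  (h.ltiChainKSDNNodeSrot hn hAcov hB).m1DopedEnergyLowerRow hU hq hp hν

end Cells

end Summit.Ventures.CertifiedManyBodySolver
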